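import Mathlib
import Summits.ResolutionOfSingularities.ResolutionOfSingularities.Theses.WeightedInvariant
import Literature.AlgebraicGeometry.Resolution.CobordantChartCoefficients
import Literature.AlgebraicGeometry.Resolution.CobordantGame
import Literature.AlgebraicGeometry.Resolution.FormalCoordinateChange
import Summits.ResolutionOfSingularities.ResolutionOfSingularities.Theorems.WeightedInvariantGlobalizeLocalDropCanonize
import Summits.ResolutionOfSingularities.ResolutionOfSingularities.Theorems.WeightedInvariantGlobalizeLocalDropCylinder
import Summits.ResolutionOfSingularities.ResolutionOfSingularities.Theorems.WeightedInvariantGlobalizeLocalDropRegularGerms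
import Summits.ResolutionOfSingularities.ResolutionOfSingularities.Theorems.WeightedInvariantLocalWeightedDropUnitRoot
import Summits.ResolutionOfSingularities.ResolutionOfSingularities.Theorems.WeightedInvariantLocalWeightedDropSliceCyl
import Summits.ResolutionOfSingularities.ResolutionOfSingularities.Theorems.WeightedInvariantLocalWeightedDropTameSliceKappa
import Summits.ResolutionOfSingularities.ResolutionOfSingularities.Theorems.WeightedInvariantLocalWeightedDropPurePowerWon
import Summits.ResolutionOfSingularities.ResolutionOfSingularities.Theorems.WeightedInvariantLocalWeightedDropContactApprox
import Summits.ResolutionOfSingularities.ResolutionOfSingularities.Theorems.WeightedInvariantLocalWeightedDropApproxPowerExact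
import Summits.ResolutionOfSingularities.ResolutionOfSingularities.Theorems.WeightedInvariantLocalWeightedDropPrepareContact
import Summits.ResolutionOfSingularities.ResolutionOfSingularities.Theorems.WeightedInvariantLocalWeightedDropFaceDropPlane
import Summits.ResolutionOfSingularities.ResolutionOfSingularities.Theorems.WeightedInvariantLocalWeightedDropPlaneAssembly
import Summits.ResolutionOfSingularities.ResolutionOfSingularities.Theorems.WeightedInvariantLocalWeightedDropPlaneWon
import Summits.ResolutionOfSingularities.ResolutionOfSingularities.Theorems.WeightedInvariantLocalWeightedDropHornedRankEquiv
import Summits.ResolutionOfSingularities.ResolutionOfSingularities.Theorems.WeightedInvariantLocalWeightedDropHyperbolicLift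
import Summits.ResolutionOfSingularities.ResolutionOfSingularities.Theorems.WeightedInvariantLocalWeightedDropCriticalSection
import Summits.ResolutionOfSingularities.ResolutionOfSingularities.Theorems.WeightedInvariantLocalWeightedDropHyperbolicSplit
import Summits.ResolutionOfSingularities.ResolutionOfSingularities.Theorems.WeightedInvariantLocalWeightedDropConeDichotomyAux
import Summits.ResolutionOfSingularities.ResolutionOfSingularities.Theorems.WeightedInvariantLocalWeightedDropConeDichotomy
import Summits.ResolutionOfSingularities.ResolutionOfSingularities.Theorems.WeightedInvariantLocalWeightedDropSquareSplit
import Summits.ResolutionOfSingularities.ResolutionOfSingularities.Theorems.WeightedInvariantLocalWeightedDropDoublePointLiftPlane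
import Summits.ResolutionOfSingularities.ResolutionOfSingularities.Theorems.WeightedInvariantLocalWeightedDropApexFreeOrderDrop
import Summits.ResolutionOfSingularities.ResolutionOfSingularities.Theorems.WeightedInvariantLocalWeightedDropPlaneBranchDropOfCount
import Literature.AlgebraicGeometry.Resolution.PlaneGermNonNCCount

/-!
# `LocalWeightedDrop`: the tangent-cone cut — the crux from one classical named fact and three cores

Route `ResolutionOfSingularities/WeightedInvariant`, crux `LocalWeightedDrop` (stmt-ResolutionOfSingularities-8899), line
`hasse-ridge-face-selection` (fourth lead): the sorry-free GLUE of the line's skeleton (Cruxes/…/Lines/hasse_ridge_face_selection.lean,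
v11) as importable theorems, so that a promoted split of the crux into its three honest cores is glued by a THEOREM:
* `hyperbolicStartsWon` — tangent quadric with a hyperbolic pair ⇒ won, given the singular germs in two fewer variables
  (landed `stub_coneDichotomy`/`stub_criticalSection`/`stub_hyperbolicSplit`/`stub_hyperbolicLift`);
* `apexFreeStartsWon` — apex-free tangent cone ⇒ won, given the singular germs of smaller order in the same number of variables
  (landed `stub_apexFreeOrderDrop` + `tameSlice`);
* `tameDoublePointSurfaceWon` — odd characteristic, `N = 3`, tangent quadric `ℓ² ≠ 0` ⇒ won, CONDITIONAL on the Literature named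
  fact `PlaneGermNonNCCount` (landed `stub_squareSplit`, `stub_doublePointLiftPlane`, `stub_planeBranchDrop_of_count`);
* `squareConeStartsWon`, `fixedDimStartsWon`, `higherStartsWon` — the (dimension, order) induction modulo the three cores;
* `localWeightedDrop_of_cores` — `PlaneGermNonNCCount` → CORE 1 → CORE 2 → CORE 3 → `LocalWeightedDrop`, with the cores spelled
  exactly as the registered stubs `stub_cubicConeStartsWon`, `stub_wildDoublePointStartsWon`, `stub_tameDoublePointHigherStartsWon`.

Deliberately NOT here: any claim about the cores themselves (open mathematics / Hironaka–Cossart–CJS for N = 3).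
-/

set_option linter.dupNamespace false -- mandated namespace of this single-conjunct summit

namespace Summit.ResolutionOfSingularities.ResolutionOfSingularities.Theorems.TangentConeCut

open Literature.AlgebraicGeometry.Resolution

variable {k : Type} [Field k]

/-- A legal coordinate change preserves singularity (`𝔪² ∖ {0}`): injectivity and `𝔪² ↦ 𝔪²`. -/
theorem isSingular_subst {n : ℕ} {θ : Fin n → MvPowerSeries (Fin n) k}
    (hθ0 : ∀ i, MvPowerSeries.constantCoeff (θ i) = 0)
    (hθdet : IsUnit (Matrix.det (Matrix.of fun i j => MvPowerSeries.coeff (Finsupp.single j 1) (θ i))))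
    {f : MvPowerSeries (Fin n) k} (hf : CobordantGame.IsSingular k f) :
    CobordantGame.IsSingular k (MvPowerSeries.subst θ f) := by
  refine ⟨FormalCoordChange.subst_ne_zero_of_isUnit_det hθ0 hθdet hf.1, ?_⟩
  rw [← FormalCoordChange.two_le_order_iff]
  exact FormalCoordChange.two_le_order_subst θ hθ0 f ((FormalCoordChange.two_le_order_iff f).mpr hf.2)

/-- Every germ in `m ≥ 1` variables is won as soon as every SINGULAR one is (`wonBy_zero_of_not_isSingular`). -/
theorem won_of_singularWon {m : ℕ} (hm : 0 < m)
    (hW : ∀ g : MvPowerSeries (Fin m) k, CobordantGame.IsSingular k g → CobordantGame.Won k m g)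
    (g : MvPowerSeries (Fin m) k) : CobordantGame.Won k m g := by
  by_cases hg : CobordantGame.IsSingular k g
  · exact hW g hg
  · exact (Summit.ResolutionOfSingularities.ResolutionOfSingularities.Theorems.wonBy_zero_of_not_isSingular
      hm hg).won

/-- THE HYPERBOLIC CASE: if every singular germ in `n + 1` variables is won, so is every singular germ in `n + 3` variables
whose tangent quadric has the hyperbolic normalisation of `stub_coneDichotomy` (critical section, splitting `f∘θ = x₀x₁ + H`,
hyperbolic lift, transport back by `won_subst_iff`). -/
theorem hyperbolicStartsWon {n : ℕ}
    (hlow : ∀ g : MvPowerSeries (Fin (n + 1)) k, CobordantGame.IsSingular k g → CobordantGame.Won k (n + 1) g)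
    (f : MvPowerSeries (Fin (n + 3)) k) (hf : CobordantGame.IsSingular k f)
    (hhyp : ∃ θ : Fin (n + 3) → MvPowerSeries (Fin (n + 3)) k, (∀ i, MvPowerSeries.constantCoeff (θ i) = 0) ∧
      IsUnit (Matrix.det (Matrix.of fun i j => MvPowerSeries.coeff (Finsupp.single j 1) (θ i))) ∧
      MvPowerSeries.coeff (Finsupp.single 0 2) (MvPowerSeries.subst θ f) = 0 ∧
      MvPowerSeries.coeff (Finsupp.single 1 2) (MvPowerSeries.subst θ f) = 0 ∧
      MvPowerSeries.coeff (Finsupp.single 0 1 + Finsupp.single 1 1) (MvPowerSeries.subst θ f) ≠ 0) :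
    CobordantGame.Won k (n + 3) f := by
  obtain ⟨θ, hθ0, hθdet, h00, h11, h01⟩ := hhyp
  have hf₁ : CobordantGame.IsSingular k (MvPowerSeries.subst θ f) := isSingular_subst hθ0 hθdet hf
  obtain ⟨θ₁, hθ₁0, hθ₁det, h00₁, h11₁, h01₁, hlin₁⟩ :=
    Summit.ResolutionOfSingularities.ResolutionOfSingularities.Theorems.stub_criticalSection k (n + 1) (MvPowerSeries.subst θ f) hf₁ h00 h11 h01
  have hf₂ : CobordantGame.IsSingular k (MvPowerSeries.subst θ₁ (MvPowerSeries.subst θ f)) :=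
    isSingular_subst hθ₁0 hθ₁det hf₁
  obtain ⟨θ₂, hθ₂0, hθ₂det, H, hH⟩ :=
    Summit.ResolutionOfSingularities.ResolutionOfSingularities.Theorems.stub_hyperbolicSplit k (n + 1) _ hf₂ h00₁ h11₁ h01₁ hlin₁
  have hWH : CobordantGame.Won k (n + 1) H := won_of_singularWon (Nat.succ_pos n) hlow H
  have hW := Summit.ResolutionOfSingularities.ResolutionOfSingularities.Theorems.stub_hyperbolicLift k (n + 1) H hWH
  rw [← hH] at hW
  rw [Summit.ResolutionOfSingularities.ResolutionOfSingularities.Theorems.won_subst_iff hθ₂0 hθ₂det,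
    Summit.ResolutionOfSingularities.ResolutionOfSingularities.Theorems.won_subst_iff hθ₁0 hθ₁det,
    Summit.ResolutionOfSingularities.ResolutionOfSingularities.Theorems.won_subst_iff hθ0 hθdet] at hW
  exact hW

/-- The constant coefficient of `x₀² + (renamed b)` is that of `b`. -/
theorem constantCoeff_X_sq_add_rename (b : MvPowerSeries (Fin 2) k) :
    MvPowerSeries.constantCoeff (MvPowerSeries.X (0 : Fin 3) ^ 2 + MvPowerSeries.rename (Fin.succEmb 2) b) =
      MvPowerSeries.constantCoeff b := by
  rw [map_add, map_pow, MvPowerSeries.constantCoeff_X, zero_pow two_ne_zero, zero_add,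
    MvPowerSeries.constantCoeff_rename]

/-- The linear coefficient of `x₀² + (renamed b)` at a renamed slot `j.succ` is that of `b` at `j`. -/
theorem coeff_single_succ_X_sq_add_rename (b : MvPowerSeries (Fin 2) k) (j : Fin 2) :
    MvPowerSeries.coeff (Finsupp.single j.succ 1)
      (MvPowerSeries.X (0 : Fin 3) ^ 2 + MvPowerSeries.rename (Fin.succEmb 2) b) =
      MvPowerSeries.coeff (Finsupp.single j 1) b := by
  rw [map_add, MvPowerSeries.coeff_X_pow, if_neg (by
    intro h
    have := congrArg (fun e => e j.succ) h
    simp [Fin.succ_ne_zero] at this), zero_add]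
  have : (Finsupp.single j.succ 1 : Fin 3 →₀ ℕ) = Finsupp.embDomain (Fin.succEmb 2) (Finsupp.single j 1) := by
    rw [Finsupp.embDomain_single]; rfl
  rw [this, MvPowerSeries.coeff_embDomain_rename]

/-- The identity substitution with all weights `1` (the point blow-up) is a legal move in `N ≥ 1` variables. -/
theorem isMove_X_one {N : ℕ} (hN : 0 < N) :
    CobordantGame.IsMove k (MvPowerSeries.X : Fin N → MvPowerSeries (Fin N) k) (fun _ => 1) := by
  refine ⟨fun i => MvPowerSeries.constantCoeff_X i, ?_, ⟨⟨0, hN⟩, one_pos⟩⟩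
  have : (Matrix.of fun i j => MvPowerSeries.coeff (Finsupp.single j 1)
      ((MvPowerSeries.X : Fin N → MvPowerSeries (Fin N) k) i)) = 1 := by
    ext i j
    rw [Matrix.of_apply, MvPowerSeries.coeff_X, Matrix.one_apply]
    by_cases h : i = j
    · subst h; simp
    · rw [if_neg (fun hh => h ((Finsupp.single_left_inj one_ne_zero).mp hh).symm), if_neg h]
  rw [this, Matrix.det_one]
  exact isUnit_one

/-- APEX-FREE STARTS ARE WON (any order `d`, any `N ≥ 1`), given the singular germs in `N` variables of order `< d`:
blow up the origin; at a singular successor `G` (point `c ≠ 0`, weight `1`, tame) the slice `S = G|_{yᵢ = 0}` has order `< d`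
off the apex (`stub_apexFreeOrderDrop`), so `S` is won and `G = u · Φ(cyl S)` (`tameSlice`) with it. -/
theorem apexFreeStartsWon (p : ℕ) (hp : p.Prime) (k : Type) [Field k] [CharP k p] {N : ℕ} (hN : 0 < N)
    (f : MvPowerSeries (Fin N) k) (d : ℕ) (hfd : f.order = d)
    (hord : ∀ g : MvPowerSeries (Fin N) k, CobordantGame.IsSingular k g → g.order < f.order →
      CobordantGame.Won k N g)
    (hapex : ∀ c : Fin N → k, c ≠ 0 → ∃ v : Fin N → k,
      CobordantChart.initEval (fun _ : Fin N => 1) (v + c) d f ≠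
        CobordantChart.initEval (fun _ : Fin N => 1) v d f) :
    CobordantGame.Won k N f := by
  refine CobordantGame.Won.move MvPowerSeries.X (fun _ => 1) (isMove_X_one hN) fun G hG => ?_
  obtain ⟨c, a, ⟨i₀, -, hci₀⟩, hfac, hndvd, -⟩ := hG
  have hc0 : c ≠ 0 := fun h => hci₀ (by rw [h]; rfl)
  -- the crux's chart with all weights `1` is `chart 1 c`, and `subst X f = f`
  have hchart : CobordantGame.cruxChart k (fun _ : Fin N => 1) c = CobordantChart.chart (fun _ : Fin N => 1) c := by
    have h := CobordantChart.cruxChart_eq_chart (k := k) (fun _ : Fin N => 1) c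
    simp only [Nat.one_pos, if_true] at h
    exact h
  have hself : MvPowerSeries.subst (MvPowerSeries.X : Fin N → MvPowerSeries (Fin N) k) f = f := by
    rw [MvPowerSeries.subst_self]; rfl
  rw [hchart, hself] at hfac
  -- tame slice at the slot `i₀` (weight `1`, never divisible by `p`)
  have hp1 : ¬ p ∣ (fun _ : Fin N => 1) i₀ := fun h => hp.one_lt.ne' (Nat.dvd_one.mp h)
  obtain ⟨Φ₂, u, hΦ0, hΦdet, hu, hGu⟩ :=
    Summit.ResolutionOfSingularities.ResolutionOfSingularities.Theorems.tameSlice p hp k N f (fun _ => 1) c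
      (fun i hi => absurd hi one_ne_zero) a G hfac i₀ hci₀ hp1
  set S : MvPowerSeries (Fin N) k := MvPowerSeries.subst
    (fun j : Fin (N + 1) => if j = i₀.succ then (0 : MvPowerSeries (Fin N) k)
      else MvPowerSeries.X (Fin.predAbove i₀ j)) G with hS
  -- the order drops off the apex
  have hSlt : S.order < (d : ℕ∞) := by
    by_contra hge
    push Not at hge
    obtain ⟨v, hv⟩ := hapex c hc0
    exact hv (Summit.ResolutionOfSingularities.ResolutionOfSingularities.Theorems.stub_apexFreeOrderDrop p hp k N f d hfd c a G hfac hndvd i₀ hci₀ hge v)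
  -- so the slice is won …
  have hWS : CobordantGame.Won k N S := by
    by_cases hSs : CobordantGame.IsSingular k S
    · exact hord S hSs (hfd ▸ hSlt)
    · exact (Summit.ResolutionOfSingularities.ResolutionOfSingularities.Theorems.wonBy_zero_of_not_isSingular
        hN hSs).won
  -- … and with it the successor `G = u · Φ₂(cyl S)`
  rw [hGu]
  exact (Summit.ResolutionOfSingularities.ResolutionOfSingularities.Theorems.won_unit_mul_iff hu _).mpr
    ((Summit.ResolutionOfSingularities.ResolutionOfSingularities.Theorems.won_subst_iff hΦ0 hΦdet _).mpr
      (Summit.ResolutionOfSingularities.ResolutionOfSingularities.Theorems.won_cyl i₀.succ hWS))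

section Cores
/-! ### The four hypotheses: the classical named fact and the three cores (verbatim registered stub signatures) -/
variable (hfact : ∀ (k : Type) [Field k] [IsAlgClosed k], Literature.AlgebraicGeometry.Resolution.PlaneGermNonNCCount k)
variable (h1 : ∀ (p : ℕ), p.Prime → ∀ (k : Type) [Field k] [CharP k p] [IsAlgClosed k]
    (n : ℕ), (∀ m : ℕ, m < n + 3 → ∀ g : MvPowerSeries (Fin m) k,
      CobordantGame.IsSingular k g → CobordantGame.Won k m g) →
    ∀ (f : MvPowerSeries (Fin (n + 3)) k), CobordantGame.IsSingular k f →
    (∀ g : MvPowerSeries (Fin (n + 3)) k, CobordantGame.IsSingular k g → g.order < f.order →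
      CobordantGame.Won k (n + 3) g) →
    (∀ i j : Fin (n + 3), MvPowerSeries.coeff (Finsupp.single i 1 + Finsupp.single j 1) f = 0) →
    ∀ (d : ℕ), f.order = d →
    (∃ c : Fin (n + 3) → k, c ≠ 0 ∧ ∀ v : Fin (n + 3) → k,
      CobordantChart.initEval (fun _ : Fin (n + 3) => 1) (v + c) d f =
        CobordantChart.initEval (fun _ : Fin (n + 3) => 1) v d f) →
    CobordantGame.Won k (n + 3) f)
variable (h2 : ∀ (k : Type) [Field k] [CharP k 2] [IsAlgClosed k]
    (n : ℕ), (∀ m : ℕ, m < n + 3 → ∀ g : MvPowerSeries (Fin m) k,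
      CobordantGame.IsSingular k g → CobordantGame.Won k m g) →
    ∀ (f : MvPowerSeries (Fin (n + 3)) k), CobordantGame.IsSingular k f →
    (∀ g : MvPowerSeries (Fin (n + 3)) k, CobordantGame.IsSingular k g → g.order < f.order →
      CobordantGame.Won k (n + 3) g) →
    (∃ ℓ : Fin (n + 3) → k, (∃ i, ℓ i ≠ 0) ∧ ∀ i j : Fin (n + 3),
      MvPowerSeries.coeff (Finsupp.single i 1 + Finsupp.single j 1) f =
        MvPowerSeries.coeff (Finsupp.single i 1 + Finsupp.single j 1)
          ((∑ l, MvPowerSeries.C (ℓ l) * MvPowerSeries.X l) ^ 2)) →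
    CobordantGame.Won k (n + 3) f)
variable (h3 : ∀ (p : ℕ), p.Prime → p ≠ 2 →
    ∀ (k : Type) [Field k] [CharP k p] [IsAlgClosed k]
    (n : ℕ), (∀ m : ℕ, m < n + 4 → ∀ g : MvPowerSeries (Fin m) k,
      CobordantGame.IsSingular k g → CobordantGame.Won k m g) →
    ∀ (f : MvPowerSeries (Fin (n + 4)) k), CobordantGame.IsSingular k f →
    (∀ g : MvPowerSeries (Fin (n + 4)) k, CobordantGame.IsSingular k g → g.order < f.order →
      CobordantGame.Won k (n + 4) g) →
    (∃ ℓ : Fin (n + 4) → k, (∃ i, ℓ i ≠ 0) ∧ ∀ i j : Fin (n + 4),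
      MvPowerSeries.coeff (Finsupp.single i 1 + Finsupp.single j 1) f =
        MvPowerSeries.coeff (Finsupp.single i 1 + Finsupp.single j 1)
          ((∑ l, MvPowerSeries.C (ℓ l) * MvPowerSeries.X l) ^ 2)) →
    CobordantGame.Won k (n + 4) f)

include hfact in
/-- TAME DOUBLE POINTS ON SURFACES ARE WON (`p ≠ 2`, `N = 3`), conditional on `PlaneGermNonNCCount`: square splitting, then
`H = 0` (pure square), or `x₀² + H` non-singular, or the double-point lift over the plane branch game. -/
theorem tameDoublePointSurfaceWon (p : ℕ) (hp : p.Prime) (hp2 : p ≠ 2) (k : Type) [Field k] [CharP k p]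
    [IsAlgClosed k] (f : MvPowerSeries (Fin 3) k) (hf : CobordantGame.IsSingular k f)
    (hsq : ∃ ℓ : Fin 3 → k, (∃ i, ℓ i ≠ 0) ∧ ∀ i j : Fin 3,
      MvPowerSeries.coeff (Finsupp.single i 1 + Finsupp.single j 1) f =
        MvPowerSeries.coeff (Finsupp.single i 1 + Finsupp.single j 1)
          ((∑ l, MvPowerSeries.C (ℓ l) * MvPowerSeries.X l) ^ 2)) :
    CobordantGame.Won k 3 f := by
  have h2 : (2 : k) ≠ 0 := by
    intro h
    have h' : ((2 : ℕ) : k) = 0 := by exact_mod_cast h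
    rw [CharP.cast_eq_zero_iff k p] at h'
    exact hp2 ((Nat.prime_dvd_prime_iff_eq hp Nat.prime_two).mp h')
  obtain ⟨θ, hθ0, hθdet, H, hH⟩ := Summit.ResolutionOfSingularities.ResolutionOfSingularities.Theorems.stub_squareSplit k h2 2 f hf hsq
  rw [← Summit.ResolutionOfSingularities.ResolutionOfSingularities.Theorems.won_subst_iff hθ0 hθdet, hH]
  by_cases hH0 : H = 0
  · -- a pure square `x₀²`
    subst hH0
    rw [map_zero, add_zero]
    have hX0 : MvPowerSeries.constantCoeff (MvPowerSeries.X (0 : Fin 3) : MvPowerSeries (Fin 3) k) = 0 :=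
      MvPowerSeries.constantCoeff_X 0
    have hX1 : ∃ i, MvPowerSeries.coeff (Finsupp.single i 1)
        (MvPowerSeries.X (0 : Fin 3) : MvPowerSeries (Fin 3) k) ≠ 0 :=
      ⟨0, by rw [MvPowerSeries.coeff_X, if_pos rfl]; exact one_ne_zero⟩
    have hW := Summit.ResolutionOfSingularities.ResolutionOfSingularities.Theorems.stub_purePowerWon k 2 1 (MvPowerSeries.X 0) 2 (by simp) hX0 hX1
    rw [one_mul] at hW
    exact hW.won
  by_cases hsing : CobordantGame.IsSingular k
      (MvPowerSeries.X (0 : Fin 3) ^ 2 + MvPowerSeries.rename (Fin.succEmb 2) H)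
  · have hHm : MvPowerSeries.constantCoeff H = 0 ∧ ∀ j, MvPowerSeries.coeff (Finsupp.single j 1) H = 0 := by
      refine ⟨?_, fun j => ?_⟩
      · rw [← constantCoeff_X_sq_add_rename H]; exact hsing.2.1
      · rw [← coeff_single_succ_X_sq_add_rename H j]; exact hsing.2.2 j.succ
    exact Summit.ResolutionOfSingularities.ResolutionOfSingularities.Theorems.stub_doublePointLiftPlane p hp hp2 k (Summit.ResolutionOfSingularities.ResolutionOfSingularities.Theorems.stub_planeBranchDrop_of_count k (hfact k)) H hH0 hHm
  · exact (Summit.ResolutionOfSingularities.ResolutionOfSingularities.Theorems.wonBy_zero_of_not_isSingular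
      (by norm_num) hsing).won

include hfact h1 h2 h3 in
/-- SQUARE-CONE STARTS modulo the cores: `ℓ = 0` ⇒ apex-free (`apexFreeStartsWon`) or CORE 1; `p = 2` ⇒ CORE 2; tame double
points: `N = 3` ⇒ `tameDoublePointSurfaceWon`, `N ≥ 4` ⇒ CORE 3. -/
theorem squareConeStartsWon (p : ℕ) (hp : p.Prime) (k : Type) [Field k] [CharP k p] [IsAlgClosed k]
    (n : ℕ) (IH : ∀ m : ℕ, m < n + 3 → ∀ g : MvPowerSeries (Fin m) k,
      CobordantGame.IsSingular k g → CobordantGame.Won k m g)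
    (f : MvPowerSeries (Fin (n + 3)) k) (hf : CobordantGame.IsSingular k f)
    (hord : ∀ g : MvPowerSeries (Fin (n + 3)) k, CobordantGame.IsSingular k g → g.order < f.order →
      CobordantGame.Won k (n + 3) g)
    (hsq : ∃ ℓ : Fin (n + 3) → k, ∀ i j : Fin (n + 3),
      MvPowerSeries.coeff (Finsupp.single i 1 + Finsupp.single j 1) f =
        MvPowerSeries.coeff (Finsupp.single i 1 + Finsupp.single j 1)
          ((∑ l, MvPowerSeries.C (ℓ l) * MvPowerSeries.X l) ^ 2)) :
    CobordantGame.Won k (n + 3) f := by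
  obtain ⟨ℓ, hℓ⟩ := hsq
  by_cases hℓ0 : ∀ i, ℓ i = 0
  · -- order ≥ 3
    have hq : ∀ i j : Fin (n + 3), MvPowerSeries.coeff (Finsupp.single i 1 + Finsupp.single j 1) f = 0 := by
      intro i j
      rw [hℓ i j]
      have : (∑ l, MvPowerSeries.C (ℓ l) * MvPowerSeries.X l : MvPowerSeries (Fin (n + 3)) k) = 0 :=
        Finset.sum_eq_zero fun l _ => by rw [hℓ0 l, map_zero, zero_mul]
      rw [this, zero_pow two_ne_zero, map_zero]
    obtain ⟨d, hd⟩ : ∃ d : ℕ, f.order = d :=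
      ⟨f.order.toNat, ((MvPowerSeries.ne_zero_iff_order_finite).mp hf.1).symm⟩
    by_cases hapex : ∃ c : Fin (n + 3) → k, c ≠ 0 ∧ ∀ v : Fin (n + 3) → k,
        CobordantChart.initEval (fun _ : Fin (n + 3) => 1) (v + c) d f =
          CobordantChart.initEval (fun _ : Fin (n + 3) => 1) v d f
    · exact h1 p hp k n IH f hf hord hq d hd hapex
    · push Not at hapex
      exact apexFreeStartsWon p hp k (Nat.succ_pos _) f d hd hord hapex
  · push Not at hℓ0
    by_cases hp2 : p = 2
    · subst hp2
      exact h2 k n IH f hf hord ⟨ℓ, hℓ0, hℓ⟩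
    · cases n with
      | zero => exact tameDoublePointSurfaceWon hfact p hp hp2 k f hf ⟨ℓ, hℓ0, hℓ⟩
      | succ n => exact h3 p hp hp2 k n IH f hf hord ⟨ℓ, hℓ0, hℓ⟩

include hfact h1 h2 h3 in
/-- ALL SINGULAR GERMS IN DIMENSION `n + 3` ARE WON given the lower dimensions (modulo the cores): inner strong induction on the
order; hyperbolic quadric ⇒ `hyperbolicStartsWon`, square ⇒ `squareConeStartsWon`. -/
theorem fixedDimStartsWon (p : ℕ) (hp : p.Prime) (k : Type) [Field k] [CharP k p] [IsAlgClosed k]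
    (n : ℕ) (IH : ∀ m : ℕ, m < n + 3 → ∀ g : MvPowerSeries (Fin m) k,
      CobordantGame.IsSingular k g → CobordantGame.Won k m g) :
    ∀ (f : MvPowerSeries (Fin (n + 3)) k), CobordantGame.IsSingular k f → CobordantGame.Won k (n + 3) f := by
  suffices key : ∀ (d : ℕ) (f : MvPowerSeries (Fin (n + 3)) k), f.order = d →
      CobordantGame.IsSingular k f → CobordantGame.Won k (n + 3) f by
    intro f hf
    exact key _ f ((MvPowerSeries.ne_zero_iff_order_finite).mp hf.1).symm hf
  intro d
  induction d using Nat.strong_induction_on with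
  | _ d IHd =>
    intro f hfd hf
    have hord : ∀ g : MvPowerSeries (Fin (n + 3)) k, CobordantGame.IsSingular k g → g.order < f.order →
        CobordantGame.Won k (n + 3) g := by
      intro g hg hlt
      have hgo : (g.order.toNat : ℕ∞) = g.order := (MvPowerSeries.ne_zero_iff_order_finite).mp hg.1
      refine IHd g.order.toNat ?_ g hgo.symm hg
      have : (g.order.toNat : ℕ∞) < (d : ℕ∞) := by rw [hgo, ← hfd]; exact hlt
      exact_mod_cast this
    rcases Summit.ResolutionOfSingularities.ResolutionOfSingularities.Theorems.stub_coneDichotomy k (n + 1) f hf with hhyp | hsq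
    · exact hyperbolicStartsWon (fun g hg => IH (n + 1) (by omega) g hg) f hf hhyp
    · exact squareConeStartsWon hfact h1 h2 h3 p hp k n IH f hf hord hsq

include hfact h1 h2 h3 in
/-- EVERY SINGULAR GERM IS WON modulo the cores: strong induction on `N`; `N ≤ 2` landed; `N = n + 3` by `fixedDimStartsWon`. -/
theorem higherStartsWon (p : ℕ) (hp : p.Prime) (k : Type) [Field k] [CharP k p] [IsAlgClosed k] :
    ∀ (N : ℕ) (f : MvPowerSeries (Fin N) k), CobordantGame.IsSingular k f → CobordantGame.Won k N f := by
  intro N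
  induction N using Nat.strong_induction_on with
  | _ N IH =>
    intro f hf
    match N, f, hf, IH with
    | 0, f, hf, _ => exact absurd hf (Summit.ResolutionOfSingularities.ResolutionOfSingularities.Theorems.PlaneWon.not_isSingular_fin_zero f)
    | 1, f, hf, _ => exact Summit.ResolutionOfSingularities.ResolutionOfSingularities.Theorems.PlaneWon.lineWon f hf
    | 2, f, hf, _ => exact Summit.ResolutionOfSingularities.ResolutionOfSingularities.Theorems.stub_planeWon k f hf
    | n + 3, f, hf, IH => exact fixedDimStartsWon hfact h1 h2 h3 p hp k n (fun m hm g hg => IH m hm g hg) f hf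

end Cores

/-- THE CRUX FROM THE NAMED FACT AND THE THREE CORES (the planner's glue for a promoted split):
`PlaneGermNonNCCount` (strong embedded resolution of plane curve germs, chart form) → CORE 1 (order `≥ 3` with a
non-trivial apex) → CORE 2 (wild double points, `p = 2`) → CORE 3 (tame double points in `≥ 4` variables) →
`LocalWeightedDrop` — by the inductive normal form and the won low-dimensional starts.  The three cores are spelled
exactly as the registered stubs `stub_cubicConeStartsWon`, `stub_wildDoublePointStartsWon`,
`stub_tameDoublePointHigherStartsWon` of the line's skeleton. -/
theorem localWeightedDrop_of_cores :
    (∀ (k : Type) [Field k] [IsAlgClosed k], Literature.AlgebraicGeometry.Resolution.PlaneGermNonNCCount k) →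
    (∀ (p : ℕ), p.Prime → ∀ (k : Type) [Field k] [CharP k p] [IsAlgClosed k]
        (n : ℕ), (∀ m : ℕ, m < n + 3 → ∀ g : MvPowerSeries (Fin m) k,
          CobordantGame.IsSingular k g → CobordantGame.Won k m g) →
        ∀ (f : MvPowerSeries (Fin (n + 3)) k), CobordantGame.IsSingular k f →
        (∀ g : MvPowerSeries (Fin (n + 3)) k, CobordantGame.IsSingular k g → g.order < f.order →
          CobordantGame.Won k (n + 3) g) →
        (∀ i j : Fin (n + 3), MvPowerSeries.coeff (Finsupp.single i 1 + Finsupp.single j 1) f = 0) →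
        ∀ (d : ℕ), f.order = d →
        (∃ c : Fin (n + 3) → k, c ≠ 0 ∧ ∀ v : Fin (n + 3) → k,
          CobordantChart.initEval (fun _ : Fin (n + 3) => 1) (v + c) d f =
            CobordantChart.initEval (fun _ : Fin (n + 3) => 1) v d f) →
        CobordantGame.Won k (n + 3) f) →
    (∀ (k : Type) [Field k] [CharP k 2] [IsAlgClosed k]
        (n : ℕ), (∀ m : ℕ, m < n + 3 → ∀ g : MvPowerSeries (Fin m) k,
          CobordantGame.IsSingular k g → CobordantGame.Won k m g) →
        ∀ (f : MvPowerSeries (Fin (n + 3)) k), CobordantGame.IsSingular k f →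
        (∀ g : MvPowerSeries (Fin (n + 3)) k, CobordantGame.IsSingular k g → g.order < f.order →
          CobordantGame.Won k (n + 3) g) →
        (∃ ℓ : Fin (n + 3) → k, (∃ i, ℓ i ≠ 0) ∧ ∀ i j : Fin (n + 3),
          MvPowerSeries.coeff (Finsupp.single i 1 + Finsupp.single j 1) f =
            MvPowerSeries.coeff (Finsupp.single i 1 + Finsupp.single j 1)
              ((∑ l, MvPowerSeries.C (ℓ l) * MvPowerSeries.X l) ^ 2)) →
        CobordantGame.Won k (n + 3) f) →
    (∀ (p : ℕ), p.Prime → p ≠ 2 →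
        ∀ (k : Type) [Field k] [CharP k p] [IsAlgClosed k]
        (n : ℕ), (∀ m : ℕ, m < n + 4 → ∀ g : MvPowerSeries (Fin m) k,
          CobordantGame.IsSingular k g → CobordantGame.Won k m g) →
        ∀ (f : MvPowerSeries (Fin (n + 4)) k), CobordantGame.IsSingular k f →
        (∀ g : MvPowerSeries (Fin (n + 4)) k, CobordantGame.IsSingular k g → g.order < f.order →
          CobordantGame.Won k (n + 4) g) →
        (∃ ℓ : Fin (n + 4) → k, (∃ i, ℓ i ≠ 0) ∧ ∀ i j : Fin (n + 4),
          MvPowerSeries.coeff (Finsupp.single i 1 + Finsupp.single j 1) f =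
            MvPowerSeries.coeff (Finsupp.single i 1 + Finsupp.single j 1)
              ((∑ l, MvPowerSeries.C (ℓ l) * MvPowerSeries.X l) ^ 2)) →
        CobordantGame.Won k (n + 4) f) →
    Summit.ResolutionOfSingularities.ResolutionOfSingularities.Theses.WeightedInvariant.LocalWeightedDrop := by
  intro hfact h1 h2 h3
  rw [Summit.ResolutionOfSingularities.ResolutionOfSingularities.Theorems.localWeightedDrop_iff_allWon]
  intro p hp k _ _ _ n f hf
  match n, f, hf with
  | 0, f, hf => exact absurd hf (Summit.ResolutionOfSingularities.ResolutionOfSingularities.Theorems.PlaneWon.not_isSingular_fin_zero f)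
  | 1, f, hf => exact Summit.ResolutionOfSingularities.ResolutionOfSingularities.Theorems.PlaneWon.lineWon f hf
  | 2, f, hf => exact Summit.ResolutionOfSingularities.ResolutionOfSingularities.Theorems.stub_planeWon k f hf
  | n + 3, f, hf => exact higherStartsWon hfact h1 h2 h3 p hp k (n + 3) f hf

end Summit.ResolutionOfSingularities.ResolutionOfSingularities.Theorems.TangentConeCut
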